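import Literature.AlgebraicGeometry.Ramification.KatoCleanRamification
import HarnessLib

/-!
# Kato-cleanliness does not depend on the local equations of the divisor: units and permutations

Topic: `Literature/AlgebraicGeometry/Ramification`. Companion to `KatoCleanRamification.lean`
(definition request `defn-KatoCleanRamification`). There, Kato-cleanliness of an Artin–Schreier
class at a point `x` of a strict normal crossings divisor `D` (Kato 1994 (3.4.3); Yatagawa 2022
Def. 1.29) was rendered through a CHOICE of local equations `z₁,…,z_n ∈ 𝒪_{X,x}` of the branches
of `D` at `x` (`IsCleanAt p z f`; `Scheme.IsKatoCleanAt` quantifies existentially over such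
choices). Kato's notion only depends on `D`: the branches at `x` are the height-one primes `(zᵢ)`,
determined by `D`, and the `zᵢ` are determined by them up to units and order. This file PROVES
that the rendering is invariant under exactly these changes:

* `poleOrderLE_unit_mul_iff`, `swanConductor_unit_mul` — pole orders and Swan conductors along
  `V(v t) = V(t)` agree (`v` a unit);
* `conductorVector_unitScale`, `isNormalForm_unitScale_iff` — for `z' = (vᵢ zᵢ)ᵢ` the conductor
  vector is unchanged and normal forms correspond by `u ↦ (∏ vᵢ^{Rᵢ}) u`;
* `LogDifferential.unitScaleEquiv : Ω¹_A(log; z) ≃ Ω¹_A(log; z')`, `dlog zᵢ ↦ dlog z'ᵢ - vᵢ⁻¹dvᵢ`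
  (Yatagawa 2022, proof of Lemma 1.15: `d(ut)/ut = dt/t + du/u`), and `rswForm_unitScale`:
  `rsw_{z'}((∏vᵢ^{Rᵢ}) u) = (∏vᵢ^{Rᵢ}) · e(rsw_z(u))`;
* `isCleanAt_unitScale_iff : IsCleanAt p (unitScale v z) f ↔ IsCleanAt p z f`;
* the same for reindexing the branches along a permutation `σ` is in
  `KatoCleanCoordinateIndependence.lean` (`isCleanAt_reindex_iff : IsCleanAt p (z ∘ σ) f ↔
  IsCleanAt p z f`), together with the matching of two systems of local equations.

(That two systems of local snc equations of the SAME divisor germ are related by a permutation and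
units is unique factorisation in the regular local ring `𝒪_{X,x}`; it is done in
`KatoCleanCoordinateIndependence.lean`.)

## Sources

* K. Kato, Amer. J. Math. 116 (1994), (3.4.2)–(3.4.3): `rsw(χ)` and cleanliness are attached to
  `(X, D, χ)`, no choices. [Kato1994Ramification]
* Y. Yatagawa, arXiv:2206.02989 (2022), Lemma 1.15 (independence of the local equation `tᵢ` up to
  units), Def. 1.29. [Yatagawa2022]
-/

noncomputable section

namespace Literature.AlgebraicGeometry.Ramification

universe u v w

open IsLocalRing

/-! ## Pole orders and Swan conductors along `V(vt) = V(t)` -/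

section PoleOrder

variable {A : Type u} [CommRing A] {K : Type v} [CommRing K] [Algebra A K] {t v : A} {m : ℕ}
  {f : K}

/-- A pole of order `≤ m` along `V(vt)` is a pole of order `≤ m` along `V(t)` (`v` a unit).
[folklore] -/
theorem PoleOrderLE.of_unit_mul (hv : IsUnit v) (h : PoleOrderLE (v * t) m f) :
    PoleOrderLE t m f := by
  obtain ⟨s, a, hs, h⟩ := h
  obtain ⟨w, hw⟩ := (hv.pow m).exists_right_inv
  refine ⟨s * v ^ m, a, fun hmem => hs ?_, ?_⟩
  · rw [Ideal.span_singleton_mul_left_unit hv]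
    have e : s = s * v ^ m * w := by rw [mul_assoc, hw, mul_one]
    rw [e]
    exact Ideal.mul_mem_right _ _ hmem
  · rw [mul_pow, ← mul_assoc] at h
    exact h

/-- Pole orders along `V(vt)` and `V(t)` agree for a unit `v`. [folklore] -/
theorem poleOrderLE_unit_mul_iff (hv : IsUnit v) : PoleOrderLE (v * t) m f ↔ PoleOrderLE t m f := by
  refine ⟨fun h => h.of_unit_mul hv, fun h => ?_⟩
  obtain ⟨w, hwv⟩ := hv.exists_left_inv
  have hw : IsUnit w := IsUnit.of_mul_eq_one v hwv
  have e : t = w * (v * t) := by rw [← mul_assoc, hwv, one_mul]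
  rw [e] at h
  exact h.of_unit_mul hw

/-- **The Swan conductor only depends on the prime divisor** `V(t) = V(vt)`. [folklore] -/
theorem swanConductor_unit_mul (p : ℕ) (hv : IsUnit v) (f : K) :
    swanConductor p (v * t) f = swanConductor p t f := by
  unfold swanConductor
  congr 1
  ext m
  simp only [Set.mem_setOf_eq, poleOrderLE_unit_mul_iff hv]

end PoleOrder

/-! ## Transport of `I • ⊤` along linear equivalences -/

section Transport

variable {A : Type u} [CommRing A] {M : Type v} {N : Type w} [AddCommGroup M] [Module A M]
  [AddCommGroup N] [Module A N]

/-- `e x ∈ I · N` iff `x ∈ I · M` for a linear equivalence `e : M ≃ N`. [folklore] -/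
theorem mem_smul_top_iff_of_linearEquiv (e : M ≃ₗ[A] N) (I : Ideal A) (x : M) :
    e x ∈ I • (⊤ : Submodule A N) ↔ x ∈ I • (⊤ : Submodule A M) := by
  have h : I • (⊤ : Submodule A N) = (I • (⊤ : Submodule A M)).map (e : M →ₗ[A] N) := by
    rw [Submodule.map_smul'', Submodule.map_top, LinearEquiv.range]
  rw [h, Submodule.mem_map_equiv, LinearEquiv.symm_apply_apply]

/-- Multiplying by a unit does not change membership in a submodule. [folklore] -/
theorem smul_mem_iff_of_units (V : Aˣ) (S : Submodule A M) (x : M) : (V : A) • x ∈ S ↔ x ∈ S :=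
  Submodule.smul_mem_iff_of_isUnit S V.isUnit

end Transport

/-! ## Rescaling the equations by units -/

section Units

variable {A : Type u} [CommRing A] {n : ℕ}

/-- The rescaled equations `z'ᵢ = vᵢ zᵢ`. [folklore] -/
def unitScale (v : Fin n → Aˣ) (z : Fin n → A) : Fin n → A := fun i => (v i : A) * z i

/-- Unfolding lemma. [folklore] -/
@[simp]
theorem unitScale_apply (v : Fin n → Aˣ) (z : Fin n → A) (i : Fin n) :
    unitScale v z i = (v i : A) * z i :=
  rfl

/-- The unit `∏ vᵢ^{Rᵢ}` relating the monomials, `z'^R = (∏ vᵢ^{Rᵢ}) z^R`. [folklore] -/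
def unitProd (v : Fin n → Aˣ) (R : Fin n → ℕ) : Aˣ := ∏ i, v i ^ R i

/-- Its value in `A`. [folklore] -/
theorem coe_unitProd (v : Fin n → Aˣ) (R : Fin n → ℕ) :
    ((unitProd v R : Aˣ) : A) = ∏ i, (v i : A) ^ R i := by
  simp [unitProd]

/-- `z'^R = (∏ vᵢ^{Rᵢ}) · z^R`. [folklore] -/
theorem monomial_unitScale (v : Fin n → Aˣ) (z : Fin n → A) (R : Fin n → ℕ) :
    monomial (unitScale v z) R = (unitProd v R : A) * monomial z R := by
  simp only [monomial, unitScale_apply, mul_pow, Finset.prod_mul_distrib, coe_unitProd]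

variable {K : Type v} [Field K] [Algebra A K] (p : ℕ) (v : Fin n → Aˣ) (z : Fin n → A) (f : K)

/-- **The conductor vector does not see the units.** [folklore] -/
theorem conductorVector_unitScale :
    conductorVector p (unitScale v z) f = conductorVector p z f := by
  funext i
  exact swanConductor_unit_mul p (v i).isUnit f

variable {p v z f}

/-- **Normal forms for `z'` and for `z` correspond** by the unit `V = ∏ vᵢ^{Rᵢ}`:
`(f - ℘g) z'^R = u'` iff `(f - ℘g) z^R = V⁻¹ u'`. [folklore] -/
theorem isNormalForm_unitScale_iff (u' : A) :
    IsNormalForm p (unitScale v z) f u' ↔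
      IsNormalForm p z f (((unitProd v (conductorVector p z f))⁻¹ : Aˣ) * u') := by
  simp only [isNormalForm_iff, conductorVector_unitScale, monomial_unitScale, map_mul]
  set V : Aˣ := unitProd v (conductorVector p z f)
  set M := algebraMap A K (monomial z (conductorVector p z f))
  have hV : algebraMap A K V * algebraMap A K ((V⁻¹ : Aˣ) : A) = 1 := by
    rw [← map_mul, Units.mul_inv, map_one]
  have hV' : algebraMap A K ((V⁻¹ : Aˣ) : A) * algebraMap A K V = 1 := by rw [mul_comm, hV]
  refine exists_congr fun g => ⟨fun h => ?_, fun h => ?_⟩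
  · calc (f - artinSchreier p g) * M
        = (f - artinSchreier p g) * M * (algebraMap A K V * algebraMap A K ((V⁻¹ : Aˣ) : A)) := by
          rw [hV, mul_one]
      _ = (f - artinSchreier p g) * (algebraMap A K V * M) * algebraMap A K ((V⁻¹ : Aˣ) : A) := by
          ring
      _ = algebraMap A K ((V⁻¹ : Aˣ) : A) * algebraMap A K u' := by rw [h, mul_comm]
  · calc (f - artinSchreier p g) * (algebraMap A K V * M)
        = (f - artinSchreier p g) * M * algebraMap A K V := by ring
      _ = algebraMap A K u' * (algebraMap A K ((V⁻¹ : Aˣ) : A) * algebraMap A K V) := by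
          rw [h]; ring
      _ = algebraMap A K u' := by rw [hV', mul_one]

end Units

/-! ## The comparison `Ω¹_A(log; z) ≃ Ω¹_A(log; z')` -/

namespace LogDifferential

variable {A : Type u} [CommRing A] {n : ℕ} (v : Fin n → Aˣ) (z : Fin n → A)

/-- The correction `ℓ(c) = Σ cᵢ vᵢ⁻¹ dvᵢ` (`dlog zᵢ = dlog z'ᵢ - vᵢ⁻¹ dvᵢ`). [folklore] -/
def unitCorrection : (Fin n → A) →ₗ[A] Ω[A⁄ℤ] :=
  ∑ i, (LinearMap.proj i).smulRight ((((v i)⁻¹ : Aˣ) : A) • KaehlerDifferential.D ℤ A (v i))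

/-- Unfolding lemma. [folklore] -/
theorem unitCorrection_apply (c : Fin n → A) :
    unitCorrection v c = ∑ i, c i • ((((v i)⁻¹ : Aˣ) : A) • KaehlerDifferential.D ℤ A (v i)) := by
  simp [unitCorrection, LinearMap.sum_apply, LinearMap.smulRight_apply]

/-- `ℓ(a eᵢ) = a vᵢ⁻¹ dvᵢ`. [folklore] -/
theorem unitCorrection_single (i : Fin n) (a : A) :
    unitCorrection v (Pi.single i a) = a • ((((v i)⁻¹ : Aˣ) : A) • KaehlerDifferential.D ℤ A (v i)) := by
  rw [unitCorrection_apply, Finset.sum_eq_single i (fun j _ hji => by simp [hji]) (by simp),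
    Pi.single_eq_same]

/-- The automorphism `(ω, c) ↦ (ω - ℓ(c), c)` of the presentation `Ω¹_A × Aⁿ`. [folklore] -/
def unitScaleAux : (Ω[A⁄ℤ] × (Fin n → A)) ≃ₗ[A] (Ω[A⁄ℤ] × (Fin n → A)) where
  toFun x := (x.1 - unitCorrection v x.2, x.2)
  invFun x := (x.1 + unitCorrection v x.2, x.2)
  map_add' x y := by
    ext
    · simp only [Prod.fst_add, Prod.snd_add, map_add]; abel
    · simp
  map_smul' r x := by
    ext
    · simp only [Prod.smul_fst, Prod.smul_snd, map_smul, smul_sub, RingHom.id_apply]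
    · simp
  left_inv x := by ext <;> simp
  right_inv x := by ext <;> simp

/-- Unfolding lemma. [folklore] -/
theorem unitScaleAux_apply (x : Ω[A⁄ℤ] × (Fin n → A)) :
    unitScaleAux v x = (x.1 - unitCorrection v x.2, x.2) :=
  rfl

/-- The relations for `z'` are unit multiples of the images of the relations for `z`:
`(d(vᵢzᵢ), -vᵢzᵢeᵢ) = vᵢ · (dzᵢ + zᵢvᵢ⁻¹dvᵢ, -zᵢeᵢ)`. [folklore] -/
theorem relation_unitScale (i : Fin n) :
    (KaehlerDifferential.D ℤ A (unitScale v z i), -Pi.single i (unitScale v z i)) =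
      (v i : A) • unitScaleAux v (KaehlerDifferential.D ℤ A (z i), -Pi.single i (z i)) := by
  rw [unitScaleAux_apply, Prod.smul_mk]
  ext
  · change KaehlerDifferential.D ℤ A ((v i : A) * z i) =
      (v i : A) • (KaehlerDifferential.D ℤ A (z i) - unitCorrection v (-Pi.single i (z i)))
    rw [Derivation.leibniz, map_neg, unitCorrection_single, sub_neg_eq_add, smul_add, smul_smul,
      smul_smul, mul_right_comm, Units.mul_inv, one_mul]
  · rename_i j
    change (-Pi.single i ((v i : A) * z i)) j = ((v i : A) • (-Pi.single i (z i))) j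
    simp only [Pi.neg_apply, Pi.single_apply, Pi.smul_apply, smul_eq_mul]
    split_ifs <;> ring

/-- The automorphism carries the relations for `z` onto the relations for `z'`. [folklore] -/
theorem map_logRelations_unitScaleAux :
    (logRelations A z).map (unitScaleAux v : (Ω[A⁄ℤ] × (Fin n → A)) →ₗ[A] _) =
      logRelations A (unitScale v z) := by
  rw [logRelations, logRelations, Submodule.map_span, ← Set.range_comp]
  refine le_antisymm (Submodule.span_le.mpr ?_) (Submodule.span_le.mpr ?_)
  · rintro _ ⟨i, rfl⟩
    have h := relation_unitScale v z i
    -- `aux(rel_z i) = vᵢ⁻¹ • rel_{z'} i`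
    have e : (unitScaleAux v) (KaehlerDifferential.D ℤ A (z i), -Pi.single i (z i)) =
        (((v i)⁻¹ : Aˣ) : A) • ((KaehlerDifferential.D ℤ A (unitScale v z i),
          -(Pi.single i (unitScale v z i) : Fin n → A)) : Ω[A⁄ℤ] × (Fin n → A)) := by
      rw [h, smul_smul, Units.inv_mul, one_smul]
    change (unitScaleAux v) (KaehlerDifferential.D ℤ A (z i), -Pi.single i (z i)) ∈ _
    rw [e]
    exact Submodule.smul_mem _ _ (Submodule.subset_span ⟨i, rfl⟩)
  · rintro _ ⟨i, rfl⟩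
    change ((KaehlerDifferential.D ℤ A (unitScale v z i),
      -(Pi.single i (unitScale v z i) : Fin n → A)) : Ω[A⁄ℤ] × (Fin n → A)) ∈ _
    rw [relation_unitScale v z i]
    exact Submodule.smul_mem _ _ (Submodule.subset_span ⟨i, rfl⟩)

/-- **The comparison isomorphism** `Ω¹_A(log; z) ≃ Ω¹_A(log; z')`, `z' = (vᵢzᵢ)`: identity on
`Ω¹_A`, `dlog zᵢ ↦ dlog z'ᵢ - vᵢ⁻¹dvᵢ` (Yatagawa 2022, proof of Lemma 1.15). Both sides present the
same stalk `Ω¹_X(log D)_x`. [cite: Yatagawa2022, Lemma 1.15] -/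
def unitScaleEquiv : LogDifferential A z ≃ₗ[A] LogDifferential A (unitScale v z) :=
  Submodule.Quotient.equiv _ _ (unitScaleAux v) (map_logRelations_unitScaleAux v z)

/-- The comparison on representatives. [folklore] -/
theorem unitScaleEquiv_mk (x : Ω[A⁄ℤ] × (Fin n → A)) :
    unitScaleEquiv v z (mk A z x) = mk A (unitScale v z) (unitScaleAux v x) :=
  rfl

/-- The comparison is the identity on `Ω¹_A`. [folklore] -/
theorem unitScaleEquiv_ofKaehler (ω : Ω[A⁄ℤ]) :
    unitScaleEquiv v z (ofKaehler A z ω) = ofKaehler A (unitScale v z) ω := by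
  rw [ofKaehler_apply, unitScaleEquiv_mk, unitScaleAux_apply, map_zero, sub_zero, ofKaehler_apply]

/-- The comparison commutes with `d`. [folklore] -/
theorem unitScaleEquiv_d (a : A) : unitScaleEquiv v z (d A z a) = d A (unitScale v z) a := by
  rw [d_apply, ← ofKaehler_apply, unitScaleEquiv_ofKaehler, ofKaehler_apply, d_apply]

/-- `dlog zᵢ ↦ dlog z'ᵢ - vᵢ⁻¹ dvᵢ`. [cite: Yatagawa2022, Lemma 1.15] -/
theorem unitScaleEquiv_dlog (i : Fin n) :
    unitScaleEquiv v z (dlog A z i) = dlog A (unitScale v z) i -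
      ofKaehler A (unitScale v z) ((((v i)⁻¹ : Aˣ) : A) • KaehlerDifferential.D ℤ A (v i)) := by
  rw [dlog_def, unitScaleEquiv_mk, unitScaleAux_apply]
  change mk A (unitScale v z) (0 - unitCorrection v (Pi.single i 1), Pi.single i 1) = _
  rw [unitCorrection_single, one_smul, zero_sub, dlog_def, ofKaehler_apply, ← map_sub]
  congr 1
  ext <;> simp

/-- A derivation on a power of a unit: `δ(w^m) = m w^m w⁻¹ δ(w)`. [folklore] -/
theorem _root_.Literature.AlgebraicGeometry.Ramification.derivation_units_pow {M : Type*}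
    [AddCommGroup M] [Module A M] [Module ℤ M] (δ : Derivation ℤ A M) (w : Aˣ) (m : ℕ) :
    δ ((w : A) ^ m) = ((m : A) * (w : A) ^ m * ((w⁻¹ : Aˣ) : A)) • δ w := by
  cases m with
  | zero => simp
  | succ m =>
    rw [Derivation.leibniz_pow, ← Nat.cast_smul_eq_nsmul A, smul_smul, Nat.add_sub_cancel]
    congr 1
    rw [pow_succ, ← mul_assoc, Units.mul_inv_cancel_right]

/-- A derivation on a product of unit powers:
`δ(∏ vᵢ^{Rᵢ}) = (∏ vᵢ^{Rᵢ}) Σ Rᵢ vᵢ⁻¹ δ(vᵢ)` ("`dlog` is additive"). [folklore] -/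
theorem _root_.Literature.AlgebraicGeometry.Ramification.derivation_prod_units_pow {M : Type*}
    [AddCommGroup M] [Module A M] [Module ℤ M] (δ : Derivation ℤ A M) (R : Fin n → ℕ)
    (S : Finset (Fin n)) :
    δ (∏ i ∈ S, (v i : A) ^ R i) =
      (∏ i ∈ S, (v i : A) ^ R i) • ∑ i ∈ S, (R i : A) • ((((v i)⁻¹ : Aˣ) : A) • δ (v i)) := by
  classical
  induction S using Finset.induction with
  | empty => simp
  | insert a S haS ih =>
    rw [Finset.prod_insert haS, Derivation.leibniz, ih, derivation_units_pow, Finset.sum_insert haS,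
      smul_add, add_comm]
    congr 1
    · simp only [smul_smul]
      congr 1
      ring
    · simp only [smul_smul, Finset.smul_sum]
      refine Finset.sum_congr rfl fun i _ => ?_
      congr 1
      ring

/-- `d(∏ vᵢ^{Rᵢ}) = (∏ vᵢ^{Rᵢ}) · ℓ(R)`. [folklore] -/
theorem D_coe_unitProd (R : Fin n → ℕ) :
    KaehlerDifferential.D ℤ A (unitProd v R : A) =
      (unitProd v R : A) • unitCorrection v (fun i => (R i : A)) := by
  rw [coe_unitProd, derivation_prod_units_pow, unitCorrection_apply]

end LogDifferential

/-! ## `rsw` and cleanliness under rescaling -/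

section UnitsClean

variable {A : Type u} [CommRing A] {n : ℕ} (v : Fin n → Aˣ) (z : Fin n → A)

/-- **The refined Swan conductor forms correspond**: for the normal form `V u` w.r.t. `z'`
(`V = ∏ vᵢ^{Rᵢ}`), `rsw_{z'}(Vu) = V · e(rsw_z(u))` under the comparison `e`. [folklore] -/
theorem rswForm_unitScale (R : Fin n → ℕ) (u : A) :
    rswForm (unitScale v z) R ((unitProd v R : A) * u) =
      (unitProd v R : A) • LogDifferential.unitScaleEquiv v z (rswForm z R u) := by
  rw [rswForm_eq_mk, rswForm_eq_mk, LogDifferential.unitScaleEquiv_mk, ← map_smul,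
    LogDifferential.unitScaleAux_apply, Prod.smul_mk]
  congr 1
  ext
  · have key : u • KaehlerDifferential.D ℤ A (unitProd v R : A) =
        (unitProd v R : A) • LogDifferential.unitCorrection v (fun i => (R i : A) * u) := by
      rw [LogDifferential.D_coe_unitProd, LogDifferential.unitCorrection_apply,
        LogDifferential.unitCorrection_apply]
      simp only [Finset.smul_sum, smul_smul]
      refine Finset.sum_congr rfl fun i _ => ?_
      congr 1
      ring
    simp only [Derivation.leibniz, neg_add_rev, smul_sub, smul_neg, key]
    abel
  · simp only [Pi.smul_apply, smul_eq_mul]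
    ring

variable {K : Type v} [Field K] [Algebra A K] {p : ℕ} {f : K}

/-- **Kato-cleanliness does not depend on the units**: `IsCleanAt p (vᵢzᵢ)ᵢ f ↔ IsCleanAt p z f`.
[cite: Kato1994Ramification, (3.4.3)] -/
theorem isCleanAt_unitScale_iff [IsLocalRing A] :
    IsCleanAt p (unitScale v z) f ↔ IsCleanAt p z f := by
  rw [isCleanAt_iff, isCleanAt_iff, conductorVector_unitScale]
  set R := conductorVector p z f
  set V : Aˣ := unitProd v R
  refine or_congr Iff.rfl ⟨?_, ?_⟩
  · rintro ⟨u', hu', hne⟩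
    refine ⟨((V⁻¹ : Aˣ) : A) * u', (isNormalForm_unitScale_iff u').mp hu', fun hmem => hne ?_⟩
    have e : u' = (V : A) * (((V⁻¹ : Aˣ) : A) * u') := by
      rw [← mul_assoc, Units.mul_inv, one_mul]
    rw [e, rswForm_unitScale]
    exact Submodule.smul_mem _ _
      ((mem_smul_top_iff_of_linearEquiv (LogDifferential.unitScaleEquiv v z) _ _).mpr hmem)
  · rintro ⟨u, hu, hne⟩
    refine ⟨(V : A) * u, (isNormalForm_unitScale_iff _).mpr ?_, fun hmem => hne ?_⟩
    · rwa [← mul_assoc, Units.inv_mul, one_mul]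
    · rw [rswForm_unitScale, smul_mem_iff_of_units] at hmem
      exact (mem_smul_top_iff_of_linearEquiv (LogDifferential.unitScaleEquiv v z) _ _).mp hmem

end UnitsClean

end Literature.AlgebraicGeometry.Ramification

end
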